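import Summits.HodgeConjecture.HodgeCM.PerL34.ArchCFockAnalytic_1

/-! PORT of `HodgeCM/PerL34/ArchCFockAnalytic.lean` (HodgeCMPerL run 82) — part 2: continuation of `Summits.HodgeConjecture.HodgeCM.PerL34.ArchCFockAnalytic_1` (split at a top-level declaration boundary by port_pkg.py; scope re-opened below; declarations unchanged). -/

-- port_pkg: scope re-opened for this part (file-level context, then the namespace/section stack open at the cut)
set_option autoImplicit false
noncomputable section
namespace HodgeCM
namespace PerL34
section Model
open HodgeCM.Prior.Perl34File HodgeCM.Prior.Perl34File.Perl34 HodgeCM.PerL34.ArchC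
variable {U : Universe}
/-- **N29 (= `Open_occ`) BY NAME from analytic Fock bridges** (carver `N29_occ`): the binders `A12/A34` of
`perL_of_leaves'` / `perL_of_dictLeaves` may be fed `Nonempty (FockAnalyticBridge …)`. -/
theorem N29_occ_of_fockAnalyticBridges (T : U.ThetaModel)
    (Pc : ∀ {L : CMField} {ι₁ : L →+* ℂ} (V : HermSpace3 L ι₁) (c : SeesawCtx L),
      C4a.PointedCore (T.core V c))
    (B12 : ∀ {L : CMField} {ι₁ : L →+* ℂ} (V : HermSpace3 L ι₁) (c : SeesawCtx L),
      T.GoodCtx ι₁ c → Nonempty (FockAnalyticBridge (T.core V c) (T.t12 V c) (Pc V c)))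
    (B34 : ∀ {L : CMField} {ι₁ : L →+* ℂ} (V : HermSpace3 L ι₁) (c : SeesawCtx L),
      T.GoodCtx ι₁ c → Nonempty (FockAnalyticBridge (T.core V c) (T.t34 V c) (Pc V c))) :
    N29_occ T :=
  (N29_iff T).mpr (Open_occ_of_fockAnalyticBridges T Pc B12 B34)

end Model

end PerL34
end HodgeCM

end
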